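import Summits.AtomisticToContinuum.BoseEinsteinCondensation.Theorems.BECThomsonPrincipleGDTransferSeededCompactDefs
import Summits.AtomisticToContinuum.BoseEinsteinCondensation.Theorems.BECConjugateDominationHardCoreExtensionMaxFormApproximationFiniteRange

/-!
# Route `BECThomsonPrinciple`, crux `GDTransfer` (stmt-AtomisticToContinuum-9482), line `seeded-continuity`
# (skeleton v8) — registered stub `stub_dilateCompactL1`: near-minimisers of the scaled potentials
# `b⁻²v(·/b)`, `b` near `1`, are `L²(cell^N)`-close to near-minimisers of `v` (step (D) of the compactness
# transport)

Supports (does not close) stmt-AtomisticToContinuum-9482: proves the registered stub `stub_dilateCompactL1`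
(signature `Sig.stub_dilateCompactL1 := EnergyUpperL1 → CompactLimitAE → AEDilationL1 → DilateCompactL1` of
`…SeededCompactDefs.lean`), taking the statements (U) `EnergyUpperL1`, (C) `CompactLimitAE` and
(A) `AEDilationL1` of the neighbouring stubs as hypotheses.

Proof, by contradiction.  If (D) fails at `(v, N = m + 1, L, η, δ₁)`, then for every `k` there are `b_k` with
`|b_k − 1| < 1/(k+1)` (and `|b_k − 1|` below the threshold of (U) at accuracy `1/(2(k+1))`) and a
`1/(2(k+1))`-near-minimiser `Φ_k` of `b_k⁻²v(·/b_k)` that is `η`-far in `L²(cell^N)` from EVERY `δ₁`-near-minimiser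
of `v`.  By (U), `E_{w_k}[Φ_k] ≤ E₀(v) + 1/(k+1)` with `w_k = b_k⁻²v(·/b_k)` and `E₀(v) < ∞`
(`periodicGroundStateEnergy_ne_top_of_integrable`).  By (A) a subsequence of the pair interactions of `w_k`
converges a.e. to that of `v`, so (C) extracts a further subsequence whose free form-domain embeddings converge
in `L²((ℝ/ℤ)^{3N})` to a unit Bose-symmetric `ζ` with maximal-form energy `Q_v(ζ) ≤ E₀(v)`.  The max-form
approximation `NearMinTower.stub_maxFormApproximationFiniteRange` at accuracy
`ε₀ = min (min δ₁ 1).toReal (η/2)` gives a `C¹` state `Ψ₁` with `E_v[Ψ₁] ≤ E₀(v) + δ₁` and `‖ιΨ₁ − ζ‖ ≤ η/2`;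
far enough along the subsequence `‖ιΦ_k − ζ‖ < η/2`, hence `‖ιΦ_k − ιΨ₁‖ < η`, i.e.
(`norm_formEmbed_sub_sq_trialState`) `∫_{cell^N} |Φ_k − Ψ₁|² < η²` — contradicting the choice of `Φ_k`.

References: LSSY2005 Ch. 2 (2.1), Ch. 5 footnote to (5.3); ReedSimonIV1978 Thm XIII.64; B. Simon,
J. Operator Theory 1 (1979) 37–47.
-/

noncomputable section

open MeasureTheory Filter UnitAddTorus
open scoped ENNReal NNReal Topology InnerProductSpace

namespace Summit.AtomisticToContinuum.BoseEinsteinCondensation.Cruxes.GDTransfer.Seeded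

open Literature.MathematicalPhysics.QuantumManyBody.BoseGas
open Literature.Barriers.AtomisticToContinuum.BoseGas (scaledPotential)
open Summit.AtomisticToContinuum.BoseEinsteinCondensation.Theses.BECThomsonPrinciple
open Summit.AtomisticToContinuum.BoseEinsteinCondensation.Cruxes.StaticResponseBound.UvThomsonForceWave
  (measurable_zeroProfile lintegral_periodicInteraction_zero_ne_top)
open Summit.AtomisticToContinuum.BoseEinsteinCondensation.Cruxes.HardCoreExtension.NearMinTower
  (stub_maxFormApproximationFiniteRange)
open Summit.AtomisticToContinuum.BoseEinsteinCondensation.Cruxes.HardCoreExtension.ThirdLawCurrentFloor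
  (norm_formEmbed_sub_sq_trialState)

-- The measure on `ℝ/ℤ` is the Haar PROBABILITY measure, as in `PeriodicFormDomain.lean`.
attribute [local instance] Literature.MathematicalPhysics.QuantumManyBody.BoseGas.formDomain_measureSpace
  Literature.MathematicalPhysics.QuantumManyBody.BoseGas.formDomain_isProbabilityMeasure
  Literature.MathematicalPhysics.QuantumManyBody.BoseGas.formDomain_isProbabilityMeasure_pi

/-- **Stub (D) `stub_dilateCompactL1`** (line `seeded-continuity`, skeleton v8): given (U) upper semicontinuity of
the ground-state energy under dilation of the profile, (C) Rellich + Fatou compactness with a.e.-convergent pair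
interactions and (A) a.e. convergence of the scaled pair interactions along subsequences, near-minimisers of the
scaled potentials `b⁻²v(·/b)` at fixed `(N, L)`, `b` near `1`, are `L²(cell^N)`-close to near-minimisers of `v`:
for every `η > 0` and slack `δ₁ > 0` there are `ϑ > 0` and `δ' > 0` such that for `|b − 1| < ϑ` every
`δ'`-near-minimiser of `b⁻²v(·/b)` is within `η` of some `δ₁`-near-minimiser of `v`.  Contradiction: along
`b_k → 1`, (U) bounds the energies by `E₀(v) + o(1)`, (A) + (C) extract an `L²`-limit `ζ` of maximal-form energy
`≤ E₀(v)`, and `NearMinTower.stub_maxFormApproximationFiniteRange` puts a `C¹` `δ₁`-near-minimiser of `v` within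
`η/2` of `ζ`. [cite: ReedSimonIV1978, Thm. XIII.64] -/
theorem stub_dilateCompactL1 : Sig.stub_dilateCompactL1 := by
  intro hUp hCpt hAE v hv hfin hint m L hL η hη δ₁ hδ₁
  by_contra H
  push Not at H
  -- `E₀(v) < ∞`
  have hE : periodicGroundStateEnergy v (m + 1) L ≠ ⊤ :=
    periodicGroundStateEnergy_ne_top_of_integrable hv.1 hint m hL
  -- the bad sequence: `|b_k - 1| < 1/(k+1)`, `Φ_k` a near-minimiser of `w_k = b_k⁻²v(·/b_k)` with
  -- `E_{w_k}[Φ_k] ≤ E₀(v) + 1/(k+1)` (by (U)), `η`-far from every `δ₁`-near-minimiser of `v`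
  have hstep : ∀ k : ℕ, ∃ b : ℝ, 0 < b ∧ |b - 1| < 1 / ((k : ℝ) + 1) ∧
      ∃ Φ : PeriodicTrialState (m + 1) L,
        periodicEnergy (scaledPotential v b) Φ ≤
            periodicGroundStateEnergy v (m + 1) L + ENNReal.ofReal (1 / ((k : ℝ) + 1)) ∧
          ∀ Ψ₁ : PeriodicTrialState (m + 1) L,
            periodicEnergy v Ψ₁ ≤ periodicGroundStateEnergy v (m + 1) L + δ₁ →
              ENNReal.ofReal (η ^ 2) < ∫⁻ X in cellN (m + 1) L, (‖Φ.ψ X - Ψ₁.ψ X‖₊ : ℝ≥0∞) ^ 2 := by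
    intro k
    have hk : (0 : ℝ) < 1 / ((k : ℝ) + 1) / 2 := by positivity
    obtain ⟨ϑ, hϑ, hU⟩ := hUp v hv hfin hint m L hL _ hk
    obtain ⟨b, hb0, hb1, Φ, hΦE, hbad⟩ :=
      H (min ϑ (1 / ((k : ℝ) + 1))) (lt_min hϑ (by positivity)) (ENNReal.ofReal (1 / ((k : ℝ) + 1) / 2))
        (ENNReal.ofReal_pos.2 hk)
    refine ⟨b, hb0, hb1.trans_le (min_le_right _ _), Φ, ?_, hbad⟩
    calc periodicEnergy (scaledPotential v b) Φ
        ≤ periodicGroundStateEnergy (scaledPotential v b) (m + 1) L +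
            ENNReal.ofReal (1 / ((k : ℝ) + 1) / 2) := hΦE
      _ ≤ periodicGroundStateEnergy v (m + 1) L + ENNReal.ofReal (1 / ((k : ℝ) + 1) / 2) +
            ENNReal.ofReal (1 / ((k : ℝ) + 1) / 2) :=
          add_le_add (hU b hb0 (hb1.trans_le (min_le_left _ _))) le_rfl
      _ = periodicGroundStateEnergy v (m + 1) L + ENNReal.ofReal (1 / ((k : ℝ) + 1)) := by
          rw [add_assoc, ← ENNReal.ofReal_add hk.le hk.le, add_halves]
  choose b hb0 hb1 Φ hΦE hbad using hstep
  -- `b_k → 1`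
  have hbt : Tendsto b atTop (𝓝 1) := by
    refine NormedAddCommGroup.tendsto_atTop.2 fun ε hε => ?_
    obtain ⟨K, hK⟩ := exists_nat_one_div_lt hε
    refine ⟨K, fun n hn => ?_⟩
    rw [Real.norm_eq_abs]
    have hKn : (K : ℝ) + 1 ≤ (n : ℝ) + 1 := by
      have h : (K : ℝ) ≤ n := by exact_mod_cast hn
      linarith
    calc |b n - 1| < 1 / ((n : ℝ) + 1) := hb1 n
      _ ≤ 1 / ((K : ℝ) + 1) := one_div_le_one_div_of_le (by positivity) hKn
      _ < ε := hK
  -- (A): a.e. convergence of the scaled pair interactions along a subsequence `φ₁`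
  obtain ⟨φ₁, hφ₁, hae⟩ := hAE v hv hfin hint (m + 1) L hL b hb0 hbt
  have hwm : ∀ k, Measurable (scaledPotential v (b (φ₁ k))) := fun k =>
    (hv.1.comp (measurable_id.div_const (b (φ₁ k)))).const_mul _
  -- the slacks `e_k = 1/(φ₁ k + 1) ≤ 1`, `e_k → 0`
  have he1 : ∀ k, ENNReal.ofReal (1 / ((φ₁ k : ℝ) + 1)) ≤ 1 := fun k =>
    ENNReal.ofReal_le_one.2 ((div_le_one (by positivity)).2 (by linarith [(φ₁ k).cast_nonneg (α := ℝ)]))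
  have he0 : Tendsto (fun k => ENNReal.ofReal (1 / ((φ₁ k : ℝ) + 1))) atTop (𝓝 0) := by
    have h := ENNReal.tendsto_ofReal
      ((tendsto_one_div_add_atTop_nhds_zero_nat (𝕜 := ℝ)).comp hφ₁.tendsto_atTop)
    rw [ENNReal.ofReal_zero] at h
    exact h
  -- (C): Rellich + Fatou along `Φ ∘ φ₁`
  obtain ⟨ζ, φ₂, -, hconv, hnorm, hBose, hQ⟩ :=
    hCpt (m + 1) L hL v hv.1 (fun k => scaledPotential v (b (φ₁ k))) hwm hae
      (periodicGroundStateEnergy v (m + 1) L) hE (fun k => ENNReal.ofReal (1 / ((φ₁ k : ℝ) + 1))) he1 he0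
      (fun k => Φ (φ₁ k)) (fun k => hΦE (φ₁ k))
  -- the accuracy `ε₀ = min (min δ₁ 1).toReal (η/2)`
  set ε₀ : ℝ := min (min δ₁ 1).toReal (η / 2) with hε₀def
  have hδ1_ne_top : min δ₁ 1 ≠ ⊤ := ne_top_of_le_ne_top ENNReal.one_ne_top (min_le_right _ _)
  have hδ1_pos : 0 < (min δ₁ 1).toReal := ENNReal.toReal_pos (lt_min hδ₁ zero_lt_one).ne' hδ1_ne_top
  have hε₀ : 0 < ε₀ := lt_min hδ1_pos (half_pos hη)
  have hε₀δ : ENNReal.ofReal ε₀ ≤ δ₁ :=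
    calc ENNReal.ofReal ε₀ ≤ ENNReal.ofReal (min δ₁ 1).toReal := ENNReal.ofReal_le_ofReal (min_le_left _ _)
      _ = min δ₁ 1 := ENNReal.ofReal_toReal hδ1_ne_top
      _ ≤ δ₁ := min_le_left _ _
  have hε₀η : ε₀ ≤ η / 2 := min_le_right _ _
  -- the `C¹` approximant `Ψ₁` of the limit profile: a `δ₁`-near-minimiser of `v` within `ε₀` of `ζ`
  obtain ⟨Ψ₁, hΨ₁E, hΨ₁d⟩ := stub_maxFormApproximationFiniteRange v hv (m + 1) L hL ζ hnorm hBose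
    (ne_top_of_le_ne_top hE hQ) ε₀ hε₀
  have hΨ₁near : periodicEnergy v Ψ₁ ≤ periodicGroundStateEnergy v (m + 1) L + δ₁ :=
    (hΨ₁E.trans (add_le_add hQ le_rfl)).trans (add_le_add le_rfl hε₀δ)
  -- an index of the subsequence `η/2`-close to `ζ`
  obtain ⟨I, hI⟩ := NormedAddCommGroup.tendsto_atTop.1 hconv (η / 2) (half_pos hη)
  have hIη := hI I le_rfl
  -- `‖ιΦ_k - ιΨ₁‖ < η` for `k = φ₁ (φ₂ I)`
  have hdist : ‖formEmbed hL measurable_zeroProfile (lintegral_periodicInteraction_zero_ne_top (m + 1) L)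
        ⟨graphEmbed hL measurable_zeroProfile (lintegral_periodicInteraction_zero_ne_top (m + 1) L)
          ⟨(Φ (φ₁ (φ₂ I))).ψ, (Φ (φ₁ (φ₂ I))).mem_periodicCore⟩, graphEmbed_mem_formDomain _ _ _ _⟩ -
      formEmbed hL measurable_zeroProfile (lintegral_periodicInteraction_zero_ne_top (m + 1) L)
        ⟨graphEmbed hL measurable_zeroProfile (lintegral_periodicInteraction_zero_ne_top (m + 1) L)
          ⟨Ψ₁.ψ, Ψ₁.mem_periodicCore⟩, graphEmbed_mem_formDomain _ _ _ _⟩‖ < η := by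
    refine (norm_sub_le_norm_sub_add_norm_sub _ ζ _).trans_lt ?_
    rw [norm_sub_rev ζ]
    linarith [hIη, hΨ₁d, hε₀η]
  -- squared and transported to `L²(cell^N)`
  have hlint : (∫⁻ X in cellN (m + 1) L, (‖(Φ (φ₁ (φ₂ I))).ψ X - Ψ₁.ψ X‖₊ : ℝ≥0∞) ^ 2).toReal < η ^ 2 := by
    rw [← norm_formEmbed_sub_sq_trialState hL (Φ (φ₁ (φ₂ I))) Ψ₁]
    exact pow_lt_pow_left₀ hdist (norm_nonneg _) two_ne_zero
  have hcont : Continuous fun X => (Φ (φ₁ (φ₂ I))).ψ X - Ψ₁.ψ X :=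
    (Φ (φ₁ (φ₂ I))).contDiff.continuous.sub Ψ₁.contDiff.continuous
  have hne : ∫⁻ X in cellN (m + 1) L, (‖(Φ (φ₁ (φ₂ I))).ψ X - Ψ₁.ψ X‖₊ : ℝ≥0∞) ^ 2 ≠ ⊤ := by
    rw [lintegral_cellN_nnnorm_sq_eq_ofReal L hcont]
    exact ENNReal.ofReal_ne_top
  have hlt : ∫⁻ X in cellN (m + 1) L, (‖(Φ (φ₁ (φ₂ I))).ψ X - Ψ₁.ψ X‖₊ : ℝ≥0∞) ^ 2 <
      ENNReal.ofReal (η ^ 2) := by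
    rw [← ENNReal.ofReal_toReal hne]
    exact (ENNReal.ofReal_lt_ofReal_iff (by positivity)).2 hlint
  -- contradiction with the badness of `Φ_k`
  exact lt_asymm hlt (hbad (φ₁ (φ₂ I)) Ψ₁ hΨ₁near)

end Summit.AtomisticToContinuum.BoseEinsteinCondensation.Cruxes.GDTransfer.Seeded

end
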